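import Summits.AtomisticToContinuum.BoseEinsteinCondensation.Theorems.BECRewardDescentRewardChordBoundNumberOperator

/-!
# The energy, mass and `n₀` as Hermitian forms on a two-dimensional span, the variational principle
# for the rewarded functional, and the `2 × 2` Temple/Feshbach algebra
# (crux `RewardChordBound`, stmt-AtomisticToContinuum-12876, stub `stub_modulusOfSimple`, helper file 2)

* `exists_polar_lintegral_energy` — for `C¹` functions `u, w` of finite periodic energy (every measurable
  pair potential, hard cores included) there is a polar form `B ∈ ℂ` with
  `E(au + bw) = |a|²E(u) + |b|²E(w) + 2 Re(ā b B)` for all `a, b ∈ ℂ` (real parts of the finite `ℝ≥0∞`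
  energies; the potential term goes through `W.toReal`, exact because `∫⁻ W|u|² < ∞`);
* `iInf_rewarded_mul_lintegral_le`, `toReal_iInf_rewarded_mul_integral_le` — the variational principle
  `R(s)‖f‖² ≤ E(f) + s(N‖f‖² - n₀(f))` for the reward infimum `R(s) = inf_Ψ (E + s(N - n₀))`;
* `form_lower_bound_on_span`, `rewarded_lower_bounds_on_span` — the real algebra of the two-level
  (Temple/Feshbach) lower bound (Cauchy–Schwarz for `q - r‖·‖²` on `span{Ψ, χ̃}`, the Ky-Fan gap for
  `χ̃`, the minimisation of `A b² - 2hσ b` over `b = ‖χ̃‖`). All `[folklore]`; no definitions.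
-/

noncomputable section

namespace Summit.AtomisticToContinuum.BoseEinsteinCondensation.Cruxes.RewardChordBound.Birth.ModulusOfSimple

open MeasureTheory Filter
open scoped ENNReal NNReal ComplexConjugate
open Literature.MathematicalPhysics.QuantumManyBody.BoseGas

section EnergyForm
variable {N : ℕ} {L : ℝ} {v : ℝ → ℝ≥0∞}

/-- The periodic interaction of a measurable profile is measurable. [folklore] -/
theorem measurable_periodicInteraction_mos (hv : Measurable v) (L : ℝ) :
    Measurable fun X : Config N => periodicInteraction v L X := by
  unfold periodicInteraction periodizedPotential
  refine Finset.measurable_sum _ fun i _ => Finset.measurable_sum _ fun j _ => ?_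
  exact (Measurable.tsum fun n => hv.comp (measurable_id.sub_const _).norm).comp
    ((measurable_pi_apply i).sub (measurable_pi_apply j))

/-- Pointwise expansion of the kinetic density on a span:
`|∇(au + bw)|² = |a|²|∇u|² + |b|²|∇w|² + 2 Re(ā b ∑ conj(∂u) ∂w)`. [folklore] -/
theorem kineticDensityReal_const_mul_add_const_mul {u w : Config N → ℂ} {X : Config N}
    (hu : DifferentiableAt ℝ u X) (hw : DifferentiableAt ℝ w X) (a b : ℂ) :
    kineticDensityReal (fun Y => a * u Y + b * w Y) X =
      ‖a‖ ^ 2 * kineticDensityReal u X + ‖b‖ ^ 2 * kineticDensityReal w X +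
        2 * (conj a * b * ∑ i : Fin N, ∑ k : Fin 3,
          (conj (fderiv ℝ u X (Pi.single i (EuclideanSpace.single k (1 : ℝ)))) *
            fderiv ℝ w X (Pi.single i (EuclideanSpace.single k (1 : ℝ))))).re := by
  have hD : fderiv ℝ (fun Y => a * u Y + b * w Y) X = a • fderiv ℝ u X + b • fderiv ℝ w X := by
    rw [fderiv_fun_add (hu.const_mul a) (hw.const_mul b), fderiv_const_mul hu, fderiv_const_mul hw]
  unfold kineticDensityReal
  simp only [hD, FunLike.coe_add, FunLike.coe_smul, Pi.add_apply, Pi.smul_apply, smul_eq_mul,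
    norm_sq_const_mul_add_const_mul, Finset.sum_add_distrib, Finset.mul_sum, Complex.re_sum]

/-- Pointwise expansion of the energy integrand (real form) on a span. [folklore] -/
theorem energyIntegrandReal_const_mul_add_const_mul {u w : Config N → ℂ} {X : Config N}
    (hu : DifferentiableAt ℝ u X) (hw : DifferentiableAt ℝ w X) (W : ℝ) (a b : ℂ) :
    kineticDensityReal (fun Y => a * u Y + b * w Y) X + W * ‖a * u X + b * w X‖ ^ 2 =
      ‖a‖ ^ 2 * (kineticDensityReal u X + W * ‖u X‖ ^ 2) +
        ‖b‖ ^ 2 * (kineticDensityReal w X + W * ‖w X‖ ^ 2) +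
        2 * (conj a * b * ((∑ i : Fin N, ∑ k : Fin 3,
          (conj (fderiv ℝ u X (Pi.single i (EuclideanSpace.single k (1 : ℝ)))) *
            fderiv ℝ w X (Pi.single i (EuclideanSpace.single k (1 : ℝ))))) +
          (W : ℂ) * (conj (u X) * w X))).re := by
  rw [kineticDensityReal_const_mul_add_const_mul hu hw, norm_sq_const_mul_add_const_mul]
  set K : ℂ := ∑ i : Fin N, ∑ k : Fin 3,
    (conj (fderiv ℝ u X (Pi.single i (EuclideanSpace.single k (1 : ℝ)))) *
      fderiv ℝ w X (Pi.single i (EuclideanSpace.single k (1 : ℝ)))) with hK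
  have h : conj a * b * ((W : ℂ) * (conj (u X) * w X)) = (W : ℂ) * (conj a * b * (conj (u X) * w X)) := by
    ring
  have h2 : (conj a * b * (K + (W : ℂ) * (conj (u X) * w X))).re =
      (conj a * b * K).re + W * (conj a * b * (conj (u X) * w X)).re := by
    rw [mul_add, Complex.add_re, h, Complex.re_ofReal_mul]
  rw [h2]
  ring

/-- The energy of a `C¹` function splits into its kinetic and potential parts. [folklore] -/
theorem lintegral_energy_eq_add (L : ℝ) {f : Config N → ℂ} (hf : ContDiff ℝ 1 f) :
    ∫⁻ X in cellN N L, (kineticDensity f X + periodicInteraction v L X * ((‖f X‖₊ : ℝ≥0∞)) ^ 2) =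
      ENNReal.ofReal (∫ X in cellN N L, kineticDensityReal f X) +
        ∫⁻ X in cellN N L, periodicInteraction v L X * ((‖f X‖₊ : ℝ≥0∞)) ^ 2 := by
  rw [lintegral_add_left (measurable_kineticDensity_of_any f), lintegral_kineticDensity_eq hf]
  rfl

/-- Real form of a finite energy: `E(f) = ∫|∇f|² + ∫ W|f|²` with `W = (∑ v^per).toReal`. [folklore] -/
theorem toReal_lintegral_energy (hv : Measurable v) (L : ℝ) {f : Config N → ℂ} (hf : ContDiff ℝ 1 f)
    (hfin : ∫⁻ X in cellN N L, (kineticDensity f X + periodicInteraction v L X * ((‖f X‖₊ : ℝ≥0∞)) ^ 2) ≠ ⊤) :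
    (∫⁻ X in cellN N L, (kineticDensity f X + periodicInteraction v L X * ((‖f X‖₊ : ℝ≥0∞)) ^ 2)).toReal =
      ∫ X in cellN N L, (kineticDensityReal f X + (periodicInteraction v L X).toReal * ‖f X‖ ^ 2) := by
  have hP : ∫⁻ X in cellN N L, periodicInteraction v L X * ((‖f X‖₊ : ℝ≥0∞)) ^ 2 ≠ ⊤ :=
    ne_top_of_le_ne_top hfin (lintegral_mono fun X => le_add_self)
  rw [lintegral_energy_eq_add L hf, ENNReal.toReal_add ENNReal.ofReal_ne_top hP,
    ENNReal.toReal_ofReal (integral_nonneg fun X => kineticDensityReal_nonneg f X),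
    ← integral_toReal_mul_norm_sq (measurable_periodicInteraction_mos hv L).aemeasurable
      hf.continuous.aestronglyMeasurable hP,
    integral_add (integrableOn_cellN (continuous_kineticDensityReal hf) L)
      (integrable_toReal_mul_norm_sq (measurable_periodicInteraction_mos hv L).aemeasurable
        hf.continuous.aestronglyMeasurable hP)]

/-- The energy of `au + bw` is finite when those of `u, w` are. [folklore] -/
theorem lintegral_energy_const_mul_add_const_mul_ne_top (hv : Measurable v) (L : ℝ) {u w : Config N → ℂ}
    (hu : ContDiff ℝ 1 u) (hw : ContDiff ℝ 1 w)
    (hu' : ∫⁻ X in cellN N L, (kineticDensity u X + periodicInteraction v L X * ((‖u X‖₊ : ℝ≥0∞)) ^ 2) ≠ ⊤)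
    (hw' : ∫⁻ X in cellN N L, (kineticDensity w X + periodicInteraction v L X * ((‖w X‖₊ : ℝ≥0∞)) ^ 2) ≠ ⊤)
    (a b : ℂ) :
    ∫⁻ X in cellN N L, (kineticDensity (fun Y => a * u Y + b * w Y) X +
      periodicInteraction v L X * ((‖a * u X + b * w X‖₊ : ℝ≥0∞)) ^ 2) ≠ ⊤ := by
  have hpar := lintegral_periodicEnergy_add_add_sub hv L (φ := fun Y => a * u Y) (ψ := fun Y => b * w Y)
    (contDiff_const.mul hu) (contDiff_const.mul hw)
  rw [lintegral_periodicEnergy_const_mul v L a hu, lintegral_periodicEnergy_const_mul v L b hw] at hpar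
  refine ne_top_of_le_ne_top ?_ (le_self_add.trans hpar.le)
  exact ENNReal.add_ne_top.2
    ⟨ENNReal.mul_ne_top ENNReal.ofNat_ne_top (ENNReal.mul_ne_top (ENNReal.pow_ne_top ENNReal.coe_ne_top) hu'),
      ENNReal.mul_ne_top ENNReal.ofNat_ne_top (ENNReal.mul_ne_top (ENNReal.pow_ne_top ENNReal.coe_ne_top) hw')⟩

/-- **The energy is a Hermitian form on a two-dimensional span** (all measurable `v`, hard cores
included): for `C¹` functions `u, w` of finite energy there is `B ∈ ℂ` (the polar form
`∫ ∑ conj(∂u)∂w + W conj(u) w`, `W = (∑ v^per).toReal`) with `E(au + bw) = |a|² E(u) + |b|² E(w) + 2 Re(ā b B)`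
for all `a, b ∈ ℂ` (where `W = ∞` both `u` and `w` vanish a.e., so `W.toReal` loses nothing). [folklore] -/
theorem exists_polar_lintegral_energy (hv : Measurable v) (L : ℝ) {u w : Config N → ℂ}
    (hu : ContDiff ℝ 1 u) (hw : ContDiff ℝ 1 w)
    (hu' : ∫⁻ X in cellN N L, (kineticDensity u X + periodicInteraction v L X * ((‖u X‖₊ : ℝ≥0∞)) ^ 2) ≠ ⊤)
    (hw' : ∫⁻ X in cellN N L, (kineticDensity w X + periodicInteraction v L X * ((‖w X‖₊ : ℝ≥0∞)) ^ 2) ≠ ⊤) :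
    ∃ B : ℂ, ∀ a b : ℂ,
      (∫⁻ X in cellN N L, (kineticDensity (fun Y => a * u Y + b * w Y) X +
        periodicInteraction v L X * ((‖a * u X + b * w X‖₊ : ℝ≥0∞)) ^ 2)).toReal =
      ‖a‖ ^ 2 * (∫⁻ X in cellN N L, (kineticDensity u X +
          periodicInteraction v L X * ((‖u X‖₊ : ℝ≥0∞)) ^ 2)).toReal +
        ‖b‖ ^ 2 * (∫⁻ X in cellN N L, (kineticDensity w X +
          periodicInteraction v L X * ((‖w X‖₊ : ℝ≥0∞)) ^ 2)).toReal +
        2 * (conj a * b * B).re := by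
  have hWm : AEMeasurable (fun X : Config N => periodicInteraction v L X) (volume.restrict (cellN N L)) :=
    (measurable_periodicInteraction_mos hv L).aemeasurable
  set K : Config N → ℂ := fun X => ∑ i : Fin N, ∑ k : Fin 3,
    (conj (fderiv ℝ u X (Pi.single i (EuclideanSpace.single k (1 : ℝ)))) *
      fderiv ℝ w X (Pi.single i (EuclideanSpace.single k (1 : ℝ)))) with hK
  have hKc : Continuous K := by
    have h1 := hu.continuous_fderiv one_ne_zero
    have h2 := hw.continuous_fderiv one_ne_zero
    simp only [hK]
    fun_prop
  have huP : ∫⁻ X in cellN N L, periodicInteraction v L X * ((‖u X‖₊ : ℝ≥0∞)) ^ 2 ≠ ⊤ :=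
    ne_top_of_le_ne_top hu' (lintegral_mono fun X => le_add_self)
  have hwP : ∫⁻ X in cellN N L, periodicInteraction v L X * ((‖w X‖₊ : ℝ≥0∞)) ^ 2 ≠ ⊤ :=
    ne_top_of_le_ne_top hw' (lintegral_mono fun X => le_add_self)
  have hiKW : Integrable (fun X => K X + ((periodicInteraction v L X).toReal : ℂ) * (conj (u X) * w X))
      (volume.restrict (cellN N L)) :=
    (integrableOn_cellN hKc L).add (integrable_toReal_mul_conj_mul hWm
      hu.continuous.aestronglyMeasurable hw.continuous.aestronglyMeasurable huP hwP)
  refine ⟨∫ X in cellN N L, (K X + ((periodicInteraction v L X).toReal : ℂ) * (conj (u X) * w X)), fun a b => ?_⟩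
  have hf : ContDiff ℝ 1 (fun Y => a * u Y + b * w Y) := (contDiff_const.mul hu).add (contDiff_const.mul hw)
  have hf' := lintegral_energy_const_mul_add_const_mul_ne_top hv L hu hw hu' hw' a b
  rw [toReal_lintegral_energy hv L hf hf', toReal_lintegral_energy hv L hu hu',
    toReal_lintegral_energy hv L hw hw']
  have hpt : ∀ X, kineticDensityReal (fun Y => a * u Y + b * w Y) X +
      (periodicInteraction v L X).toReal * ‖a * u X + b * w X‖ ^ 2 =
      ‖a‖ ^ 2 * (kineticDensityReal u X + (periodicInteraction v L X).toReal * ‖u X‖ ^ 2) +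
        ‖b‖ ^ 2 * (kineticDensityReal w X + (periodicInteraction v L X).toReal * ‖w X‖ ^ 2) +
        2 * (conj a * b * (K X + ((periodicInteraction v L X).toReal : ℂ) * (conj (u X) * w X))).re := fun X =>
    energyIntegrandReal_const_mul_add_const_mul ((hu.differentiable one_ne_zero) X)
      ((hw.differentiable one_ne_zero) X) (periodicInteraction v L X).toReal a b
  simp_rw [hpt]
  have hiu : Integrable (fun X => kineticDensityReal u X + (periodicInteraction v L X).toReal * ‖u X‖ ^ 2)
      (volume.restrict (cellN N L)) :=
    (integrableOn_cellN (continuous_kineticDensityReal hu) L).add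
      (integrable_toReal_mul_norm_sq hWm hu.continuous.aestronglyMeasurable huP)
  have hiw : Integrable (fun X => kineticDensityReal w X + (periodicInteraction v L X).toReal * ‖w X‖ ^ 2)
      (volume.restrict (cellN N L)) :=
    (integrableOn_cellN (continuous_kineticDensityReal hw) L).add
      (integrable_toReal_mul_norm_sq hWm hw.continuous.aestronglyMeasurable hwP)
  have hi3 : Integrable (fun X => 2 * (conj a * b * (K X + ((periodicInteraction v L X).toReal : ℂ) * (conj (u X) * w X))).re)
      (volume.restrict (cellN N L)) :=
    ((hiKW.const_mul (conj a * b)).re).const_mul 2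
  have hA : Integrable (fun X => ‖a‖ ^ 2 * (kineticDensityReal u X + (periodicInteraction v L X).toReal * ‖u X‖ ^ 2) +
      ‖b‖ ^ 2 * (kineticDensityReal w X + (periodicInteraction v L X).toReal * ‖w X‖ ^ 2)) (volume.restrict (cellN N L)) :=
    (hiu.const_mul _).add (hiw.const_mul _)
  rw [integral_add hA hi3, integral_add (hiu.const_mul _) (hiw.const_mul _), integral_const_mul,
    integral_const_mul, integral_const_mul]
  congr 1
  have h := integral_re (hiKW.const_mul (conj a * b))
  simp only [RCLike.re_to_complex] at h
  rw [h, integral_const_mul]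
end EnergyForm

/-! ### The variational principle for the rewarded functional on unnormalised functions -/
section Variational
variable {N : ℕ} {L : ℝ}

/-- **Variational principle for `F_s = E + s(N‖·‖² - n₀)` on unnormalised functions** (`ℝ≥0∞`):
for every `C¹`, `Lℤ³`-periodic, Bose-symmetric `f` with `0 < ‖f‖²_cell < ∞`,
`R(s) ‖f‖² ≤ E(f) + s (N‖f‖² - n₀(f))`, `R(s) = inf_Ψ F_s(Ψ)` (normalise `f`; `E`, `n₀` scale
quadratically). [folklore] -/
theorem iInf_rewarded_mul_lintegral_le (v : ℝ → ℝ≥0∞) (s : ℝ) {f : Config N → ℂ}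
    (hf : ContDiff ℝ 1 f)
    (hper : ∀ (X : Config N) (i : Fin N) (k : Fin 3),
      f (X + Pi.single i (EuclideanSpace.single k L)) = f X)
    (hsymm : ∀ (σ : Equiv.Perm (Fin N)) (X : Config N), f (X ∘ σ) = f X)
    (h0 : ∫⁻ X in cellN N L, ((‖f X‖₊ : ℝ≥0∞)) ^ 2 ≠ 0)
    (htop : ∫⁻ X in cellN N L, ((‖f X‖₊ : ℝ≥0∞)) ^ 2 ≠ ⊤) :
    (⨅ Ψ : PeriodicTrialState N L, (periodicEnergy v Ψ +
        ENNReal.ofReal s * ((N : ℝ≥0∞) - condensateOccupation N L Ψ.ψ))) *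
        ∫⁻ X in cellN N L, ((‖f X‖₊ : ℝ≥0∞)) ^ 2 ≤
      (∫⁻ X in cellN N L, (kineticDensity f X + periodicInteraction v L X * ((‖f X‖₊ : ℝ≥0∞)) ^ 2)) +
        ENNReal.ofReal s * ((N : ℝ≥0∞) * (∫⁻ X in cellN N L, ((‖f X‖₊ : ℝ≥0∞)) ^ 2) -
          condensateOccupation N L f) := by
  set m := ∫⁻ X in cellN N L, ((‖f X‖₊ : ℝ≥0∞)) ^ 2 with hm
  obtain ⟨Ψ, a, hΨ, ha⟩ := exists_periodicTrialState_const_mul hf hper hsymm h0 htop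
  have hE : periodicEnergy v Ψ = m⁻¹ * ∫⁻ X in cellN N L,
      (kineticDensity f X + periodicInteraction v L X * ((‖f X‖₊ : ℝ≥0∞)) ^ 2) := by
    unfold periodicEnergy
    rw [hΨ, lintegral_periodicEnergy_const_mul v L (a : ℂ) hf, ha]
  have hn : condensateOccupation N L Ψ.ψ = m⁻¹ * condensateOccupation N L f := by
    rw [hΨ, condensateOccupation_const_mul, ha]
  have hmm : m⁻¹ * m = 1 := ENNReal.inv_mul_cancel h0 htop
  calc _ ≤ (periodicEnergy v Ψ + ENNReal.ofReal s * ((N : ℝ≥0∞) - condensateOccupation N L Ψ.ψ)) * m :=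
        mul_le_mul_left (iInf_le _ Ψ) m
    _ = _ := by
        rw [hE, hn, add_mul, mul_comm m⁻¹, mul_assoc, hmm, mul_one, mul_assoc,
          ENNReal.sub_mul (fun _ _ => htop), mul_comm m⁻¹, mul_assoc, hmm, mul_one]

/-- **Variational principle for the rewarded functional, real form** (`L > 0`, `s ≥ 0`, `f` `C¹` periodic
Bose-symmetric of finite energy and non-zero mass): `R(s) ∫‖f‖² ≤ E(f) + s (N ∫‖f‖² - n₀(f))`. [folklore] -/
theorem toReal_iInf_rewarded_mul_integral_le (hL : 0 < L) (v : ℝ → ℝ≥0∞) {s : ℝ} (hs : 0 ≤ s)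
    {f : Config N → ℂ} (hf : ContDiff ℝ 1 f)
    (hper : ∀ (X : Config N) (i : Fin N) (k : Fin 3),
      f (X + Pi.single i (EuclideanSpace.single k L)) = f X)
    (hsymm : ∀ (σ : Equiv.Perm (Fin N)) (X : Config N), f (X ∘ σ) = f X)
    (h0 : (∫ X in cellN N L, ‖f X‖ ^ 2) ≠ 0)
    (hEf : ∫⁻ X in cellN N L, (kineticDensity f X + periodicInteraction v L X * ((‖f X‖₊ : ℝ≥0∞)) ^ 2) ≠ ⊤) :
    (⨅ Ψ : PeriodicTrialState N L, (periodicEnergy v Ψ +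
        ENNReal.ofReal s * ((N : ℝ≥0∞) - condensateOccupation N L Ψ.ψ))).toReal *
        ∫ X in cellN N L, ‖f X‖ ^ 2 ≤
      (∫⁻ X in cellN N L, (kineticDensity f X + periodicInteraction v L X * ((‖f X‖₊ : ℝ≥0∞)) ^ 2)).toReal +
        s * (N * (∫ X in cellN N L, ‖f X‖ ^ 2) - (condensateOccupation N L f).toReal) := by
  have hmeq := lintegral_cellN_nnnorm_sq_eq_ofReal L hf.continuous
  have hI0 : 0 ≤ ∫ X in cellN N L, ‖f X‖ ^ 2 := integral_nonneg fun X => sq_nonneg _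
  have hm0 : ∫⁻ X in cellN N L, ((‖f X‖₊ : ℝ≥0∞)) ^ 2 ≠ 0 := by
    rw [hmeq]; exact (ENNReal.ofReal_pos.2 (lt_of_le_of_ne hI0 (Ne.symm h0))).ne'
  have hmtop : ∫⁻ X in cellN N L, ((‖f X‖₊ : ℝ≥0∞)) ^ 2 ≠ ⊤ := by rw [hmeq]; exact ENNReal.ofReal_ne_top
  have h := iInf_rewarded_mul_lintegral_le v s hf hper hsymm hm0 hmtop
  have hn_le : condensateOccupation N L f ≤ (N : ℝ≥0∞) * ∫⁻ X in cellN N L, ((‖f X‖₊ : ℝ≥0∞)) ^ 2 :=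
    condensateOccupation_le_card_mul_lintegral hL hf.continuous
  have hNm : (N : ℝ≥0∞) * (∫⁻ X in cellN N L, ((‖f X‖₊ : ℝ≥0∞)) ^ 2) ≠ ⊤ :=
    ENNReal.mul_ne_top (ENNReal.natCast_ne_top N) hmtop
  have hsub := ENNReal.sub_ne_top hNm (b := condensateOccupation N L f)
  have hrhs : (∫⁻ X in cellN N L, (kineticDensity f X + periodicInteraction v L X * ((‖f X‖₊ : ℝ≥0∞)) ^ 2)) +
      ENNReal.ofReal s * ((N : ℝ≥0∞) * (∫⁻ X in cellN N L, ((‖f X‖₊ : ℝ≥0∞)) ^ 2) -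
        condensateOccupation N L f) ≠ ⊤ :=
    ENNReal.add_ne_top.2 ⟨hEf, ENNReal.mul_ne_top ENNReal.ofReal_ne_top hsub⟩
  have h2 := ENNReal.toReal_mono hrhs h
  rw [ENNReal.toReal_mul, ENNReal.toReal_add hEf (ENNReal.mul_ne_top ENNReal.ofReal_ne_top hsub),
    ENNReal.toReal_mul, ENNReal.toReal_ofReal hs, ENNReal.toReal_sub_of_le hn_le hNm,
    ENNReal.toReal_mul, ENNReal.toReal_natCast, hmeq, ENNReal.toReal_ofReal hI0] at h2
  exact h2
end Variational

/-! ### The `2 × 2` (Temple/Feshbach) algebra -/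
section Algebra

/-- **Lower bound for the shifted form on a two-dimensional span.** Let `q` be a quadratic form on
`span{Ψ, χ̃}` (`‖Ψ‖ = 1`, `χ̃ ⊥ Ψ`, `‖χ̃‖² = m`, values `qΨ = q(Ψ)`, `qχ = q(χ̃)`, polar form `B`)
with `q ≥ r‖·‖²` on the span, `q(Ψ) ≤ r + δ` and `q(χ̃) ≥ (r + g - δ) m`. Then for
`Φ = c₀Ψ + χ̃` with `|c₀|² = 1 - m`:
`q(Φ) ≥ r + (1 - √δ) m (g - δ) - √δ` (Cauchy–Schwarz `|B|² ≤ (qΨ - r)(qχ - rm) ≤ δ(qχ - rm)` for the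
non-negative form `q - r‖·‖²`, then `2|c₀||B| ≤ √δ(|c₀|² + qχ - rm)`). [folklore] -/
theorem form_lower_bound_on_span {r δ g m qΨ qχ qΦ : ℝ} {c₀ B : ℂ} (hδ0 : 0 < δ) (hδ1 : δ ≤ 1)
    (hδg : δ ≤ g) (hm0 : 0 ≤ m) (hc₀ : ‖c₀‖ ^ 2 = 1 - m)
    (hvar : ∀ t : ℂ, r * (1 + ‖t‖ ^ 2 * m) ≤ qΨ + ‖t‖ ^ 2 * qχ + 2 * (t * B).re)
    (hΨ : qΨ ≤ r + δ) (hχ : (r + g - δ) * m ≤ qχ)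
    (hΦ : qΦ = ‖c₀‖ ^ 2 * qΨ + qχ + 2 * (conj c₀ * B).re) :
    r + (1 - Real.sqrt δ) * (m * (g - δ)) - Real.sqrt δ ≤ qΦ := by
  have hr : r ≤ qΨ := by have := hvar 0; simpa using this
  have hQ : m * (g - δ) ≤ qχ - r * m := by
    linarith [hχ, show (r + g - δ) * m = r * m + m * (g - δ) by ring]
  have hQ0 : 0 ≤ qχ - r * m := le_trans (mul_nonneg hm0 (by linarith)) hQ
  -- Cauchy–Schwarz for the non-negative form `q - r‖·‖²` on the span
  have hCS : ‖B‖ ^ 2 ≤ (qΨ - r) * (qχ - r * m) := by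
    by_cases hB : B = 0
    · rw [hB, norm_zero, zero_pow two_ne_zero]
      exact mul_nonneg (by linarith) hQ0
    have hBn : (‖B‖ : ℝ) ≠ 0 := norm_ne_zero_iff.mpr hB
    have hBc : ((‖B‖ : ℝ) : ℂ) ≠ 0 := by exact_mod_cast hBn
    have key : ∀ x : ℝ, 0 ≤ (qΨ - r) + 2 * x * (-‖B‖) + x ^ 2 * (qχ - r * m) := by
      intro x
      set t : ℂ := -(x : ℂ) * (conj B / (‖B‖ : ℂ)) with ht
      have hu1 : ‖conj B / (‖B‖ : ℂ)‖ = 1 := by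
        rw [norm_div, Complex.norm_conj, Complex.norm_real, Real.norm_of_nonneg (norm_nonneg _),
          div_self hBn]
      have htn : ‖t‖ ^ 2 = x ^ 2 := by
        rw [ht, norm_mul, norm_neg, Complex.norm_real, hu1, mul_one, Real.norm_eq_abs, sq_abs]
      have htB : (t * B).re = -x * ‖B‖ := by
        have h1 : t * B = -(x : ℂ) * (‖B‖ : ℂ) := by
          rw [ht, mul_assoc, div_mul_eq_mul_div, Complex.conj_mul', sq, mul_div_assoc, div_self hBc,
            mul_one]
        rw [h1, ← Complex.ofReal_neg, ← Complex.ofReal_mul, Complex.ofReal_re, neg_mul]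
      have h := hvar t
      rw [htn, htB] at h
      linarith
    have h := sq_le_mul_of_forall_quadratic_nonneg key
    rwa [neg_sq] at h
  have hB2 : ‖B‖ ^ 2 ≤ δ * (qχ - r * m) := hCS.trans (mul_le_mul_of_nonneg_right (by linarith) hQ0)
  have hBle : ‖B‖ ≤ Real.sqrt δ * Real.sqrt (qχ - r * m) := by
    rw [← Real.sqrt_mul hδ0.le]
    have h := Real.abs_le_sqrt hB2
    rwa [abs_norm] at h
  have hre : |(conj c₀ * B).re| ≤ ‖c₀‖ * ‖B‖ :=
    (Complex.abs_re_le_norm _).trans (by rw [norm_mul, Complex.norm_conj])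
  have hre' : -(‖c₀‖ * ‖B‖) ≤ (conj c₀ * B).re := (abs_le.1 hre).1
  -- `2|c₀||B| ≤ √δ (|c₀|² + Q)`
  have hsq : Real.sqrt (qχ - r * m) ^ 2 = qχ - r * m := Real.sq_sqrt hQ0
  have hAMGM : 2 * (‖c₀‖ * ‖B‖) ≤ Real.sqrt δ * (‖c₀‖ ^ 2 + (qχ - r * m)) := by
    calc 2 * (‖c₀‖ * ‖B‖) ≤ 2 * (‖c₀‖ * (Real.sqrt δ * Real.sqrt (qχ - r * m))) := by
          gcongr
      _ = Real.sqrt δ * (2 * ‖c₀‖ * Real.sqrt (qχ - r * m)) := by ring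
      _ ≤ Real.sqrt δ * (‖c₀‖ ^ 2 + Real.sqrt (qχ - r * m) ^ 2) :=
          mul_le_mul_of_nonneg_left (two_mul_le_add_sq _ _) (Real.sqrt_nonneg _)
      _ = _ := by rw [hsq]
  have hsδ1 : Real.sqrt δ ≤ 1 := Real.sqrt_le_one.mpr hδ1 |>.trans_eq' (by simp)
  have h1 : (1 - Real.sqrt δ) * (m * (g - δ)) ≤ (1 - Real.sqrt δ) * (qχ - r * m) :=
    mul_le_mul_of_nonneg_left hQ (by linarith)
  have h2 : 0 ≤ Real.sqrt δ * m := mul_nonneg (Real.sqrt_nonneg _) hm0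
  rw [hΦ, hc₀]
  rw [hc₀] at hAMGM
  nlinarith [hAMGM, hre', h1, h2, hr]

/-- **Lower bounds for `F_(s±h) = q ± h·dep` on the span.** With the output of `form_lower_bound_on_span`
for `q = F_s`, the depletion form `dep = N‖·‖² - n₀` (values `dΨ, dχ ∈ [0, N‖·‖²]`, polar form `D` with
`|D|² ≤ m σ²`) and `0 < A ≤ (1 - √δ)(g - δ) - hN`: `F_(s±h)(Φ) ≥ r ± h·dep(Ψ) - h²σ²/A - √δ`. [folklore] -/
theorem rewarded_lower_bounds_on_span {r δ g m qΦ dΨ dΦ dχ h Nr σ2 A : ℝ} {c₀ D : ℂ}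
    (hq : r + (1 - Real.sqrt δ) * (m * (g - δ)) - Real.sqrt δ ≤ qΦ)
    (hm0 : 0 ≤ m) (hc₀ : ‖c₀‖ ^ 2 = 1 - m)
    (hdΦ : dΦ = ‖c₀‖ ^ 2 * dΨ + dχ + 2 * (conj c₀ * D).re)
    (hD : ‖D‖ ^ 2 ≤ m * σ2) (hσ : 0 ≤ σ2)
    (hdΨ0 : 0 ≤ dΨ) (hdΨN : dΨ ≤ Nr) (hdχ0 : 0 ≤ dχ) (hdχN : dχ ≤ Nr * m)
    (hh : 0 ≤ h) (hA : 0 < A) (hAle : A ≤ (1 - Real.sqrt δ) * (g - δ) - h * Nr) :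
    r + h * dΨ - h ^ 2 * σ2 / A - Real.sqrt δ ≤ qΦ + h * dΦ ∧
      r - h * dΨ - h ^ 2 * σ2 / A - Real.sqrt δ ≤ qΦ - h * dΦ := by
  set ρ : ℝ := Real.sqrt (m * σ2) with hρ
  have hρ0 : 0 ≤ ρ := Real.sqrt_nonneg _
  have hρ2 : ρ ^ 2 = m * σ2 := Real.sq_sqrt (mul_nonneg hm0 hσ)
  have hDρ : ‖D‖ ≤ ρ := by have h := Real.abs_le_sqrt hD; rwa [abs_norm] at h
  have hc₀1 : ‖c₀‖ ≤ 1 := by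
    have : ‖c₀‖ ^ 2 ≤ 1 := by rw [hc₀]; linarith
    exact (pow_le_one_iff_of_nonneg (norm_nonneg _) two_ne_zero).1 this
  have hre0 : |(conj c₀ * D).re| ≤ ‖c₀‖ * ‖D‖ :=
    (Complex.abs_re_le_norm _).trans (by rw [norm_mul, Complex.norm_conj])
  have hre : |(conj c₀ * D).re| ≤ ρ :=
    hre0.trans ((mul_le_mul hc₀1 hDρ (norm_nonneg _) zero_le_one).trans_eq (one_mul ρ))
  obtain ⟨hre1, hre2⟩ := abs_le.1 hre
  have hmd0 : 0 ≤ m * dΨ := mul_nonneg hm0 hdΨ0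
  have hmdN : m * dΨ ≤ m * Nr := mul_le_mul_of_nonneg_left hdΨN hm0
  have hup : dΦ ≤ dΨ + Nr * m + 2 * ρ := by rw [hdΦ, hc₀]; nlinarith
  have hlo : dΨ - Nr * m - 2 * ρ ≤ dΦ := by rw [hdΦ, hc₀]; nlinarith
  -- the quadratic in `b = √m`: `mA - 2hρ ≥ -h²σ²/A`
  have hquad : -(h ^ 2 * σ2 / A) ≤ m * A - 2 * h * ρ := by
    have hbr : 0 ≤ m * A ^ 2 - 2 * h * ρ * A + h ^ 2 * σ2 := by
      rcases hm0.eq_or_lt with hm | hm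
      · have hρ0' : ρ = 0 := by rw [hρ, ← hm, zero_mul, Real.sqrt_zero]
        rw [← hm, hρ0']; nlinarith [mul_nonneg (sq_nonneg h) hσ]
      · have key : m * (m * A ^ 2 - 2 * h * ρ * A + h ^ 2 * σ2) = (m * A - h * ρ) ^ 2 := by
          linear_combination (-(h ^ 2)) * hρ2
        have : m * 0 ≤ m * (m * A ^ 2 - 2 * h * ρ * A + h ^ 2 * σ2) := by
          rw [key, mul_zero]; exact sq_nonneg _
        exact le_of_mul_le_mul_left this hm
    have heq : m * A - 2 * h * ρ + h ^ 2 * σ2 / A = (m * A ^ 2 - 2 * h * ρ * A + h ^ 2 * σ2) / A := by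
      field_simp
    linarith [div_nonneg hbr hA.le, heq]
  have hmA : m * A ≤ m * ((1 - Real.sqrt δ) * (g - δ) - h * Nr) := mul_le_mul_of_nonneg_left hAle hm0
  have hhup : h * dΦ ≤ h * (dΨ + Nr * m + 2 * ρ) := mul_le_mul_of_nonneg_left hup hh
  have hhlo : h * (dΨ - Nr * m - 2 * ρ) ≤ h * dΦ := mul_le_mul_of_nonneg_left hlo hh
  constructor <;> nlinarith [hq, hquad, hmA, hhup, hhlo]
end Algebra

end Summit.AtomisticToContinuum.BoseEinsteinCondensation.Cruxes.RewardChordBound.Birth.ModulusOfSimple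

namespace Summit.AtomisticToContinuum.BoseEinsteinCondensation.Cruxes.RewardChordBound.Birth

/-- **Registered sub-goal of stub `stub_modulusOfSimple` (helper file 2): the two-level (Temple/Feshbach)
lower bound on a span** — `q(Φ) ≥ r + (1 - √δ) m (g - δ) - √δ` from `q ≥ r‖·‖²` on `span{Ψ, χ̃}`,
`q(Ψ) ≤ r + δ`, `q(χ̃) ≥ (r + g - δ)‖χ̃‖²`. [folklore] -/
theorem stub_modulusOfSimpleFormLowerBound :
    ∀ (r δ g m qΨ qχ qΦ : ℝ) (c₀ B : ℂ), 0 < δ → δ ≤ 1 → δ ≤ g → 0 ≤ m → ‖c₀‖ ^ 2 = 1 - m → (∀ t : ℂ, r * (1 + ‖t‖ ^ 2 * m) ≤ qΨ + ‖t‖ ^ 2 * qχ + 2 * (t * B).re) → qΨ ≤ r + δ → (r + g - δ) * m ≤ qχ → qΦ = ‖c₀‖ ^ 2 * qΨ + qχ + 2 * (starRingEnd ℂ c₀ * B).re → r + (1 - Real.sqrt δ) * (m * (g - δ)) - Real.sqrt δ ≤ qΦ :=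
  fun _ _ _ _ _ _ _ _ _ hδ0 hδ1 hδg hm0 hc₀ hvar hΨ hχ hΦ =>
    ModulusOfSimple.form_lower_bound_on_span hδ0 hδ1 hδg hm0 hc₀ hvar hΨ hχ hΦ

end Summit.AtomisticToContinuum.BoseEinsteinCondensation.Cruxes.RewardChordBound.Birth

end
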